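/-
Copyright: the b2b-balaban T⁴-continuum CRUX team, row NE7b leaf lineage `t4-ne7b-formalise-leaf-04` (gen 145; v1.4 gen 146). Project licence.
-/
import Summits.QuantumFields.BalabanUV.T4Continuum.Spine.NE7b.ConvexTiltMomentPi
import Summits.QuantumFields.BalabanUV.T4Continuum.Spine.NE7b.UniformlyConvexTiltedMoments
import Summits.QuantumFields.BalabanUV.T4Continuum.Spine.NE7b.GaussianShiftedFibre

/-!
# THE CONVEXITY ROAD IN PRODUCT COORDINATES WITH DATA `(λ, V, q ≥ 0, u)` ONLY: leaf-06's dischargers of `hZ ∕ h1 ∕ h2`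
# (`…UniformlyConvexTiltedMoments`, on `EuclideanSpace ℝ (Fin n)`) carried through the chart of `…ConvexTiltMomentPi` to `ι → ℝ`
# — and the letter's SUPPLIER for a fibre weight `e^{−(xᵀSx + P(x))}` (row NE7b, node U5c; residual (R2′), family (2); junction corollaries)

Cell `pub-balaban`, sub-cell `t4`, spine estimate NE7b (`T4WeightBudget.RelWeightBound`; NOT PRINTED in [Bałaban 1983–89], NOT PROVED).
Crux-route work under `Spine/NE7b/` (FREEZE (0) crux-prover clause); NOTHING of Bałaban's named or asserted; no `Support` leaf; no
`def`; zero `sorry`.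

WHY.  `…ConvexTiltMomentPi.exp_moment_le_of_uniformlyConvex_pi(_window)` transport the OWNER's ENDs to product-Lebesgue coordinates with
the three integrability binders `hZ ∕ h1 ∕ h2` DISPLAYED; `…UniformlyConvexTiltedMoments` (leaf-06 g146) proves all three FOLLOW from the
convexity letter on `EuclideanSpace ℝ (Fin n)`.  The junction named in both INTENTs (l.53283 ∕ l.53265: «binder-free `_pi` corollaries are two
lines through `integrable(_tilted)_comp_chart_iff` — whoever types them») is this file: in product coordinates the road's data are
`(λ; V continuous, first-order λ-convex in fderiv ∕ sum-of-squares form; q ≥ 0; u)` and, on a window, `(K, η, hmass)` — nothing else.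

WHAT IS PROVED ([folklore]; the two parents BY NAME, Mathlib matrix algebra):
* §1 `integrable_exp_neg_of_uniformlyConvex_pi`, `integrable_dotProduct_tilted_of_uniformlyConvex_pi`,
  `integrable_dotProduct_sq_tilted_of_uniformlyConvex_pi` (the three binders discharged on `ι → ℝ`), **`exp_moment_le_of_uniformlyConvex_pi_free`**,
  **`exp_moment_le_of_uniformlyConvex_window_pi_free`**, and the subgradient-letter forms `…_pi_free'` ∕ `…_window_pi_free'`.
* §2 THE SUPPLIER OF THE LETTER IN PRODUCT COORDINATES (the OWNER's `ConvexTiltSuppliers.firstOrder_quadratic_add` in the fibre files'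
  letters, proved directly by matrix algebra — no transport; the symmetric-form identity `xᵀSy = yᵀSx` is the OWNER's
  `GaussianShiftedFibre.dotProduct_mulVec_symm` BY NAME): `differentiable_dotProduct_mulVec`,
  `differentiable_dotProduct_left`, `firstOrder_add_affine_pi` (affine terms — e.g. the exterior shift `2x₁ᵀS₁₂x₂` of a coupled fibre — ride inside `P` at no cost),
  **`firstOrder_quadratic_add_pi`** (`S` symmetric with `σ·Σ_i v_i² ≤ vᵀSv`, `P` with the `dP`-letter of modulus `−h` ⊢ `V = xᵀSx + P` has the
  `dV`-letter with `dV x = 2·Sx + dP x` and modulus `2σ − h`), and the assembled consumer ENDs **`exp_moment_le_of_quadratic_add_pi`** ∕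
  **`exp_moment_le_of_quadratic_add_window_pi`**: for the fibre weight `e^{−(xᵀSx + P(x))}` with `2σ − h > 0` the sacrificed exponential moment of
  `Σ_k q_k (u_k ⬝ᵥ x)²` is at most `exp(Σ_k q_k·((2σ−h)⁻¹Σ_i (u_k)_i² + m_k²))` — «Hessian-small ⇒ the road applies» with data
  `(S, σ, P, dP, h; q ≥ 0, u)` only (refuter κ-g67-5 family (2); T-60a′ at `λ = 2σ − h`).
NOT HERE (honest): anything of Bałaban's — WHICH `S`, `σ`, `P`, `h` his small-field fibres afford (Δ4), the tilted means `m_k` ((R1″)-class, inside the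
conclusion), `η`; the coupled-block bookkeeping (exterior shift `2x₁ᵀS₁₂x₂` as part of `P` or of the letter — the OWNER's call).  BY-NAME EFFECT ON
THE WALL: NONE.  NE7b NOT PRINTED ∕ NOT PROVED; spine PROVED 0∕9; rung (B)+1 on a FINITE torus — NOT infinite volume, NOT the mass gap, NOT Clay.
HONEST DEPENDENCY: continuum YM on T⁴ ⇐ BetaPertH ∧ nine spine estimates (0/9 proved); BetaPertH ⇐ (D1) ∧ (D4) ∧ CAP+tail; G-an2-4 gates asym,
D1 and NE2/3/4.
-/

set_option autoImplicit false

noncomputable section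

open MeasureTheory Real Finset
open scoped RealInnerProductSpace

namespace Summit.QuantumFields.BalabanUV.T4Continuum.NE7b.ConvexTiltMomentPiFree

open Summit.QuantumFields.BalabanUV.T4Continuum.NE7b.ConvexTiltMomentPi
open Summit.QuantumFields.BalabanUV.T4Continuum.NE7b.UniformlyConvexTiltedMoments
open Summit.QuantumFields.BalabanUV.T4Continuum.NE7b.GaussianShiftedFibre (dotProduct_mulVec_symm)

variable {ι : Type*} [Fintype ι]

/-- `e^{−V}` is integrable on `ι → ℝ` under the `fderiv`-form convexity letter (`V` continuous): leaf-06's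
`integrable_exp_neg_of_uniformlyConvex` (tree Literature lemma) pulled through a chart. [folklore] -/
theorem integrable_exp_neg_of_uniformlyConvex_pi {V : (ι → ℝ) → ℝ} {lam : ℝ} (hlam : 0 < lam) (hVc : Continuous V)
    (hV : ∀ x y : ι → ℝ, V x + fderiv ℝ V x (y - x) + lam / 2 * ∑ i, (y i - x i) ^ 2 ≤ V y) :
    Integrable fun x => exp (-V x) := by
  obtain ⟨T, hT, hTn⟩ := exists_chart ι
  exact (integrable_comp_chart_iff T hT (fun y => exp (-V y))).1
    (Literature.Analysis.FunctionSpaces.integrable_exp_neg_of_uniformlyConvex hlam (hVc.comp T.continuous)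
      (uniformlyConvex_comp T hTn hV))

/-- `u ⬝ᵥ x ∈ L¹(ν_V)` on `ι → ℝ` under the convexity letter. [folklore] -/
theorem integrable_dotProduct_tilted_of_uniformlyConvex_pi {V : (ι → ℝ) → ℝ} {lam : ℝ} (hlam : 0 < lam) (hVc : Continuous V)
    (hV : ∀ x y : ι → ℝ, V x + fderiv ℝ V x (y - x) + lam / 2 * ∑ i, (y i - x i) ^ 2 ≤ V y) (u : ι → ℝ) :
    Integrable (fun x => u ⬝ᵥ x) (volume.tilted fun x => -V x) := by
  obtain ⟨T, hT, hTn⟩ := exists_chart ι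
  have h := integrable_inner_tilted_of_uniformlyConvex hlam (hVc.comp T.continuous) (uniformlyConvex_comp T hTn hV) (T.symm u)
  simp_rw [inner_symm_eq_dotProduct T hTn] at h
  exact (integrable_tilted_comp_chart_iff T hT (integrable_exp_neg_of_uniformlyConvex_pi hlam hVc hV) (fun y => u ⬝ᵥ y)).1 h

/-- `(u ⬝ᵥ x)² ∈ L¹(ν_V)` on `ι → ℝ` under the convexity letter. [folklore] -/
theorem integrable_dotProduct_sq_tilted_of_uniformlyConvex_pi {V : (ι → ℝ) → ℝ} {lam : ℝ} (hlam : 0 < lam) (hVc : Continuous V)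
    (hV : ∀ x y : ι → ℝ, V x + fderiv ℝ V x (y - x) + lam / 2 * ∑ i, (y i - x i) ^ 2 ≤ V y) (u : ι → ℝ) :
    Integrable (fun x => (u ⬝ᵥ x) ^ 2) (volume.tilted fun x => -V x) := by
  obtain ⟨T, hT, hTn⟩ := exists_chart ι
  have h := integrable_inner_sq_tilted_of_uniformlyConvex hlam (hVc.comp T.continuous) (uniformlyConvex_comp T hTn hV) (T.symm u)
  simp_rw [inner_symm_eq_dotProduct T hTn] at h
  exact (integrable_tilted_comp_chart_iff T hT (integrable_exp_neg_of_uniformlyConvex_pi hlam hVc hV) (fun y => (u ⬝ᵥ y) ^ 2)).1 h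

/-- **THE CONVEXITY ROAD IN PRODUCT COORDINATES, DATA `(λ, V, q ≥ 0, u)` ONLY** = `ConvexTiltMomentPi.exp_moment_le_of_uniformlyConvex_pi`
with `hZ ∕ h1 ∕ h2` discharged. [folklore] -/
theorem exp_moment_le_of_uniformlyConvex_pi_free {V : (ι → ℝ) → ℝ} {lam : ℝ} {r : ℕ} (hlam : 0 < lam) (hVc : Continuous V)
    (hV : ∀ x y : ι → ℝ, V x + fderiv ℝ V x (y - x) + lam / 2 * ∑ i, (y i - x i) ^ 2 ≤ V y)
    (q : Fin r → ℝ) (hq : ∀ k, 0 ≤ q k) (u : Fin r → ι → ℝ) :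
    ∫ x, exp (-V x) ≤
      exp (∑ k, q k * (lam⁻¹ * ∑ i, u k i ^ 2 + (∫ x, u k ⬝ᵥ x ∂(volume.tilted fun x => -V x)) ^ 2)) *
        ∫ x, exp (-(V x + ∑ k, q k * (u k ⬝ᵥ x) ^ 2)) :=
  exp_moment_le_of_uniformlyConvex_pi hlam hVc hV (integrable_exp_neg_of_uniformlyConvex_pi hlam hVc hV) q hq u
    (fun k => integrable_dotProduct_tilted_of_uniformlyConvex_pi hlam hVc hV (u k))
    (fun k => integrable_dotProduct_sq_tilted_of_uniformlyConvex_pi hlam hVc hV (u k))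

/-- **THE WINDOWED ROAD IN PRODUCT COORDINATES, DATA `(λ, V, q ≥ 0, u; K, η, hmass)` ONLY.** [folklore] -/
theorem exp_moment_le_of_uniformlyConvex_window_pi_free {V : (ι → ℝ) → ℝ} {lam η : ℝ} {r : ℕ} (hlam : 0 < lam)
    (hVc : Continuous V) (hV : ∀ x y : ι → ℝ, V x + fderiv ℝ V x (y - x) + lam / 2 * ∑ i, (y i - x i) ^ 2 ≤ V y)
    (q : Fin r → ℝ) (hq : ∀ k, 0 ≤ q k) (u : Fin r → ι → ℝ) (K : Set (ι → ℝ)) (hη : η < 1)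
    (hmass : (1 - η) * ∫ x, exp (-V x) ≤ ∫ x in K, exp (-V x)) :
    ∫ x in K, exp (-V x) ≤
      exp ((∑ k, q k * (lam⁻¹ * ∑ i, u k i ^ 2 + (∫ x, u k ⬝ᵥ x ∂(volume.tilted fun x => -V x)) ^ 2)) / (1 - η)) *
        ∫ x in K, exp (-(V x + ∑ k, q k * (u k ⬝ᵥ x) ^ 2)) :=
  exp_moment_le_of_uniformlyConvex_window_pi hlam hVc hV (integrable_exp_neg_of_uniformlyConvex_pi hlam hVc hV) q hq u
    (fun k => integrable_dotProduct_tilted_of_uniformlyConvex_pi hlam hVc hV (u k))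
    (fun k => integrable_dotProduct_sq_tilted_of_uniformlyConvex_pi hlam hVc hV (u k)) K hη hmass

/-- **DATA `(λ, V differentiable, dV, q ≥ 0, u)` ONLY**: the subgradient letter of `ConvexTiltMomentPi` §3 with the binders discharged.
[folklore] -/
theorem exp_moment_le_of_uniformlyConvex_pi_free' {V : (ι → ℝ) → ℝ} {lam : ℝ} {r : ℕ} (hlam : 0 < lam) (hVd : Differentiable ℝ V)
    (dV : (ι → ℝ) → (ι → ℝ)) (hV : ∀ x y : ι → ℝ, V x + dV x ⬝ᵥ (y - x) + lam / 2 * ∑ i, (y i - x i) ^ 2 ≤ V y)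
    (q : Fin r → ℝ) (hq : ∀ k, 0 ≤ q k) (u : Fin r → ι → ℝ) :
    ∫ x, exp (-V x) ≤
      exp (∑ k, q k * (lam⁻¹ * ∑ i, u k i ^ 2 + (∫ x, u k ⬝ᵥ x ∂(volume.tilted fun x => -V x)) ^ 2)) *
        ∫ x, exp (-(V x + ∑ k, q k * (u k ⬝ᵥ x) ^ 2)) :=
  exp_moment_le_of_uniformlyConvex_pi_free hlam hVd.continuous (firstOrder_fderiv_of_dV hVd hV) q hq u

/-- **THE WINDOWED ROAD, SUBGRADIENT LETTER, BINDERS DISCHARGED.** [folklore] -/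
theorem exp_moment_le_of_uniformlyConvex_window_pi_free' {V : (ι → ℝ) → ℝ} {lam η : ℝ} {r : ℕ} (hlam : 0 < lam)
    (hVd : Differentiable ℝ V) (dV : (ι → ℝ) → (ι → ℝ))
    (hV : ∀ x y : ι → ℝ, V x + dV x ⬝ᵥ (y - x) + lam / 2 * ∑ i, (y i - x i) ^ 2 ≤ V y)
    (q : Fin r → ℝ) (hq : ∀ k, 0 ≤ q k) (u : Fin r → ι → ℝ) (K : Set (ι → ℝ)) (hη : η < 1)
    (hmass : (1 - η) * ∫ x, exp (-V x) ≤ ∫ x in K, exp (-V x)) :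
    ∫ x in K, exp (-V x) ≤
      exp ((∑ k, q k * (lam⁻¹ * ∑ i, u k i ^ 2 + (∫ x, u k ⬝ᵥ x ∂(volume.tilted fun x => -V x)) ^ 2)) / (1 - η)) *
        ∫ x in K, exp (-(V x + ∑ k, q k * (u k ⬝ᵥ x) ^ 2)) :=
  exp_moment_le_of_uniformlyConvex_window_pi_free hlam hVd.continuous (firstOrder_fderiv_of_dV hVd hV) q hq u K hη hmass

/-! ## §2 The supplier of the letter in product coordinates: a coercive symmetric form plus a semiconvex perturbation -/

section Supplier

open scoped Matrix

/-- The quadratic form `x ↦ x ⬝ᵥ S x` is differentiable on `ι → ℝ` (a finite sum of products of coordinates). [folklore] -/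
theorem differentiable_dotProduct_mulVec (S : Matrix ι ι ℝ) : Differentiable ℝ fun x : ι → ℝ => x ⬝ᵥ (S *ᵥ x) := by
  have e : (fun x : ι → ℝ => x ⬝ᵥ (S *ᵥ x)) = fun x => ∑ i, x i * ∑ j, S i j * x j := by
    funext x; rfl
  rw [e]
  fun_prop

/-- A linear functional `x ↦ c ⬝ᵥ x` is differentiable on `ι → ℝ`. [folklore] -/
theorem differentiable_dotProduct_left (c : ι → ℝ) : Differentiable ℝ fun x : ι → ℝ => c ⬝ᵥ x := by
  have e : (fun x : ι → ℝ => c ⬝ᵥ x) = fun x => ∑ i, c i * x i := by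
    funext x; rfl
  rw [e]
  fun_prop

/-- **AFFINE TERMS RIDE INSIDE THE PERTURBATION AT NO COST**: adding `x ↦ c ⬝ᵥ x + d` to `P` keeps the `dP`-letter with the SAME
modulus and `dP ↦ dP + c` (the case of use: the exterior shift `2x₁ᵀS₁₂x₂` of a coupled near fibre, `c = 2·S₁₂x₂` at fixed far field).
[folklore] -/
theorem firstOrder_add_affine_pi {P : (ι → ℝ) → ℝ} {dP : (ι → ℝ) → (ι → ℝ)} {h : ℝ}
    (hP : ∀ x y : ι → ℝ, P x + dP x ⬝ᵥ (y - x) + (-h) / 2 * ∑ i, (y i - x i) ^ 2 ≤ P y) (c : ι → ℝ) (d : ℝ)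
    (x y : ι → ℝ) :
    (P x + (c ⬝ᵥ x + d)) + (dP x + c) ⬝ᵥ (y - x) + (-h) / 2 * ∑ i, (y i - x i) ^ 2 ≤ P y + (c ⬝ᵥ y + d) := by
  have hPxy := hP x y
  rw [add_dotProduct, dotProduct_sub c y x]
  linarith

/-- **COERCIVE SYMMETRIC FORM PLUS A SEMICONVEX PERTURBATION, IN PRODUCT COORDINATES** (the OWNER's
`ConvexTiltSuppliers.firstOrder_quadratic_add` in the fibre files' letters): if `S` is symmetric with `σ·Σ_i v_i² ≤ v ⬝ᵥ S v` and `P`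
satisfies the first-order inequality with SOME vector field `dP` and modulus `−h` (`P x + dP x ⬝ᵥ (y − x) − (h∕2)Σ_i (y_i − x_i)² ≤ P y`
— «Hessian ≥ −h» in first-order form), then `V = x ⬝ᵥ S x + P` satisfies the `dV`-letter of `ConvexTiltMomentPi` §3 with
`dV x = 2·S x + dP x` and modulus `2σ − h` (exact second-order identity for the quadratic part). [folklore] -/
theorem firstOrder_quadratic_add_pi {S : Matrix ι ι ℝ} (hS : S.IsSymm) {σ h : ℝ}
    (hσ : ∀ v : ι → ℝ, σ * ∑ i, v i ^ 2 ≤ v ⬝ᵥ (S *ᵥ v)) {P : (ι → ℝ) → ℝ} {dP : (ι → ℝ) → (ι → ℝ)}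
    (hP : ∀ x y : ι → ℝ, P x + dP x ⬝ᵥ (y - x) + (-h) / 2 * ∑ i, (y i - x i) ^ 2 ≤ P y) (x y : ι → ℝ) :
    (x ⬝ᵥ (S *ᵥ x) + P x) + ((2 : ℝ) • S *ᵥ x + dP x) ⬝ᵥ (y - x) + (2 * σ - h) / 2 * ∑ i, (y i - x i) ^ 2 ≤
      y ⬝ᵥ (S *ᵥ y) + P y := by
  set d : ι → ℝ := y - x with hd
  have hy : y = x + d := by rw [hd]; abel
  have hsq : ∑ i, (y i - x i) ^ 2 = ∑ i, d i ^ 2 := Finset.sum_congr rfl fun i _ => by rw [hd, Pi.sub_apply]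
  have hdd : ∑ i, d i ^ 2 = d ⬝ᵥ d := by rw [dotProduct]; exact Finset.sum_congr rfl fun i _ => sq (d i)
  -- the quadratic part: exact expansion
  have hq : y ⬝ᵥ (S *ᵥ y) = x ⬝ᵥ (S *ᵥ x) + 2 * (x ⬝ᵥ (S *ᵥ d)) + d ⬝ᵥ (S *ᵥ d) := by
    rw [hy, Matrix.mulVec_add, dotProduct_add, add_dotProduct, add_dotProduct, dotProduct_mulVec_symm hS d x]
    ring
  have hlin : ((2 : ℝ) • S *ᵥ x + dP x) ⬝ᵥ d = 2 * (x ⬝ᵥ (S *ᵥ d)) + dP x ⬝ᵥ d := by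
    rw [add_dotProduct, smul_dotProduct, smul_eq_mul, dotProduct_comm (S *ᵥ x) d, dotProduct_mulVec_symm hS d x]
  have hcoer := hσ d
  have hPxy := hP x y
  rw [hsq] at hPxy ⊢
  rw [hlin, hq]
  nlinarith [hcoer, hPxy, hdd]

/-- **THE CONVEXITY ROAD FOR A FIBRE WEIGHT `e^{−(xᵀSx + P(x))}`, DATA `(S, σ, P, dP, h; q ≥ 0, u)` ONLY**: `S` symmetric with
`σ·Σv_i² ≤ vᵀSv`, `P` differentiable and `(−h)`-semiconvex in the `dP` letter, `2σ − h > 0`; then for the sacrificed form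
`g = Σ_k q_k (u_k ⬝ᵥ x)²`: `∫e^{−(xᵀSx+P)} ≤ exp(Σ_k q_k·((2σ−h)⁻¹·Σ_i (u_k)_i² + m_k²))·∫e^{−(xᵀSx+P+g)}`, `m_k` the tilted means —
«Hessian-small ⇒ the road applies», in the fibre files' letters (refuter κ-g67-5 family (2); T-60a′ with `λ = 2σ − h`). [folklore] -/
theorem exp_moment_le_of_quadratic_add_pi {S : Matrix ι ι ℝ} (hS : S.IsSymm) {σ h : ℝ}
    (hσ : ∀ v : ι → ℝ, σ * ∑ i, v i ^ 2 ≤ v ⬝ᵥ (S *ᵥ v)) {P : (ι → ℝ) → ℝ} (hPd : Differentiable ℝ P)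
    {dP : (ι → ℝ) → (ι → ℝ)} (hP : ∀ x y : ι → ℝ, P x + dP x ⬝ᵥ (y - x) + (-h) / 2 * ∑ i, (y i - x i) ^ 2 ≤ P y)
    (hgap : 0 < 2 * σ - h) {r : ℕ} (q : Fin r → ℝ) (hq : ∀ k, 0 ≤ q k) (u : Fin r → ι → ℝ) :
    ∫ x, exp (-(x ⬝ᵥ (S *ᵥ x) + P x)) ≤
      exp (∑ k, q k * ((2 * σ - h)⁻¹ * ∑ i, u k i ^ 2 +
          (∫ x, u k ⬝ᵥ x ∂(volume.tilted fun x : ι → ℝ => -(x ⬝ᵥ (S *ᵥ x) + P x))) ^ 2)) *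
        ∫ x, exp (-((x ⬝ᵥ (S *ᵥ x) + P x) + ∑ k, q k * (u k ⬝ᵥ x) ^ 2)) :=
  exp_moment_le_of_uniformlyConvex_pi_free' hgap ((differentiable_dotProduct_mulVec S).add hPd)
    (fun x => (2 : ℝ) • S *ᵥ x + dP x) (firstOrder_quadratic_add_pi hS hσ hP) q hq u

/-- **THE SAME ON A WINDOW `K`** carrying the tilted mass fraction `1 − η`. [folklore] -/
theorem exp_moment_le_of_quadratic_add_window_pi {S : Matrix ι ι ℝ} (hS : S.IsSymm) {σ h η : ℝ}
    (hσ : ∀ v : ι → ℝ, σ * ∑ i, v i ^ 2 ≤ v ⬝ᵥ (S *ᵥ v)) {P : (ι → ℝ) → ℝ} (hPd : Differentiable ℝ P)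
    {dP : (ι → ℝ) → (ι → ℝ)} (hP : ∀ x y : ι → ℝ, P x + dP x ⬝ᵥ (y - x) + (-h) / 2 * ∑ i, (y i - x i) ^ 2 ≤ P y)
    (hgap : 0 < 2 * σ - h) {r : ℕ} (q : Fin r → ℝ) (hq : ∀ k, 0 ≤ q k) (u : Fin r → ι → ℝ) (K : Set (ι → ℝ)) (hη : η < 1)
    (hmass : (1 - η) * ∫ x, exp (-(x ⬝ᵥ (S *ᵥ x) + P x)) ≤ ∫ x in K, exp (-(x ⬝ᵥ (S *ᵥ x) + P x))) :
    ∫ x in K, exp (-(x ⬝ᵥ (S *ᵥ x) + P x)) ≤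
      exp ((∑ k, q k * ((2 * σ - h)⁻¹ * ∑ i, u k i ^ 2 +
          (∫ x, u k ⬝ᵥ x ∂(volume.tilted fun x : ι → ℝ => -(x ⬝ᵥ (S *ᵥ x) + P x))) ^ 2)) / (1 - η)) *
        ∫ x in K, exp (-((x ⬝ᵥ (S *ᵥ x) + P x) + ∑ k, q k * (u k ⬝ᵥ x) ^ 2)) :=
  exp_moment_le_of_uniformlyConvex_window_pi_free' hgap ((differentiable_dotProduct_mulVec S).add hPd)
    (fun x => (2 : ℝ) • S *ᵥ x + dP x) (firstOrder_quadratic_add_pi hS hσ hP) q hq u K hη hmass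

end Supplier

end Summit.QuantumFields.BalabanUV.T4Continuum.NE7b.ConvexTiltMomentPiFree

end
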